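import Summits.BirchSwinnertonDyer.BirchSwinnertonDyer.Theorems.ThetaPartnerAtTwoSignedKatoUpToAtTwoOffTwo
import Literature.NumberTheory.EllipticCurves.CyclotomicIwasawaMainTheoremIrreducibleProofs
import HarnessLib

/-!
# Route `ThetaPartnerAtTwo` (TP2), crux K2r0P `SignedMainConjectureCMTwoRankZeroOfPub` (stmt-BirchSwinnertonDyer-24945),
# line `rankzero` v14: LENGTH CURRENCY — both research shapes of the CM port (the registered lower stub (LD±2^k) and the
# two-sided promote text D_MC) are statements about local lengths at the height-one primes of `Λ = ℤ_p⟦T⟧` NOT containing `p`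

HONEST FRAMING (cell `pub/bsd-wall`, W-ALL row 1, lead prover `bsd-wall-tp2-p2` g8, 2026-08-28). Nothing here is the crux and
BSD is not proved by any of this. The load-bearing registered stub (LD±2^k)_A of skeleton `rankzero` v14 and the two-sided
promote text D_MC («(MC±2^k)_A», the shape a port of Kato 2004 Prop. 15.9 / (15.6.4) / Lemma 15.13 + Johnson-Leung–Kings 2011
Thm. 5.2 delivers; cell memos `Cruxes/…/ER2-PRINT-SOURCE-w2.md` §5 (P1)–(P4), `PR04-AT-TWO.md`) are stated in the crux's
`Λ ⊗ ℚ_p` currency `C(p^{m'})·ι g = C(p^m·ϖ)·ι(L·h)`. The K3 seats' Kato-at-2 frame (`SignedKatoOffTwo.*`) works in LOCAL LENGTHS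
`ℓ_𝔭` at height-one primes `𝔭 ∌ p` and proved the UPPER (Kato) half of the dictionary
(`SignedKatoOffTwo.katoUpTo_iff_lengthAt_le_off_p`). This file completes the dictionary, for any prime `p`, any number field, any
sign `ε`, any signed Selmer dual datum `D` with `X^ε` torsion, `L ∈ Λ ∖ 0`, `ϖ ∈ ℚˣ`:
* `lowerUpTo_iff_lengthAt_le_off_p`: the LOWER (Eisenstein) shape `∃ g h m m', char X^ε = (g) ∧ C(p^{m'})·ι g = C(p^m·ϖ)·ι(L·h)`
  (the registered stub's shape) ⟺ `∀ height-one 𝔭 ∌ p, ℓ_𝔭(Λ/(L)) ≤ ℓ_𝔭(X^ε)`;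
* `upTo_iff_lengthAt_eq_off_p`: the TWO-SIDED shape `∃ g m m', char X^ε = (g) ∧ C(p^{m'})·ι g = C(p^m·ϖ)·ι L` (D_MC's shape)
  ⟺ `∀ height-one 𝔭 ∌ p, ℓ_𝔭(X^ε) = ℓ_𝔭(Λ/(L))` — `ϖ` and the `p`-powers are invisible off `p`, as they must be.
The `p = 2` doors for the crux (registered stub, D_MC, crux BODY from (MC-len)_A) are in the sibling file `…LengthDoors.lean`.

References: [Kobayashi2003] Thm. 1.3 (i) (p. 2), Thm. 4.1 (p. 8); [Kato2004Asterisque] Prop. 15.9 (p. 258), Lemma 15.13 (p. 264),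
Thm. 17.4 (2) (p. 273); [JohnsonLeungKings2011] Thm. 5.2; [Washington1997] §13.2; [PollackRubin2004] Thm. 7.3 (p > 2).
-/

set_option autoImplicit false
-- the Theorems namespace of this sub repeats the summit name by design (D-0017 nested layout)
set_option linter.dupNamespace false

noncomputable section

open scoped Classical MatrixGroups ModularForm

open CongruenceSubgroup WeierstrassCurve Literature.NumberTheory.EllipticCurves
  Literature.NumberTheory.EllipticCurves.ModularForms Literature.NumberTheory.EllipticCurves.Module
  Literature.NumberTheory.EllipticCurves.Rank1Residual
  Literature.NumberTheory.EllipticCurves.Kobayashi2003 ZpExtension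
  Summit.BirchSwinnertonDyer.Rank1Residual.Supersingular

namespace Summit.BirchSwinnertonDyer.BirchSwinnertonDyer.Theorems

namespace SignedLengthDoors

/-! ## §1 Any prime `p`, any sign, any dual datum: the two shapes in local lengths off `p` -/

section AnyPrime

variable {p : ℕ} [Fact p.Prime] {K : Type} [Field K] [NumberField K] {W : WeierstrassCurve K} [W.IsElliptic]
  {κ : ZpExtension K p} {γ : Field.absoluteGaloisGroup K} {ε : ℤˣ}

/-- `Λ/(a)` is a torsion `Λ`-module for `a ≠ 0` (killed by `a`). [folklore] -/
private theorem isTorsion_quotient_span_singleton {a : IwasawaAlgebra p} (ha : a ≠ 0) :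
    Module.IsTorsion (IwasawaAlgebra p) (IwasawaAlgebra p ⧸ Ideal.span {a}) := by
  have hby : Module.IsTorsionBy (IwasawaAlgebra p) (IwasawaAlgebra p ⧸ Ideal.span {a}) a :=
    (Module.isTorsionBy_quotient_iff _ a).mpr fun y ↦ by
      rw [smul_eq_mul]
      exact Ideal.mul_mem_right y _ (Ideal.mem_span_singleton_self a)
  exact fun x ↦ ⟨⟨a, mem_nonZeroDivisors_of_ne_zero ha⟩, @hby x⟩

/-- `ι(C c · x) = C c · ι x` for `c ∈ ℤ_p` (coefficientwise inclusion `ι : Λ ↪ ℚ_p⟦T⟧`). [folklore] -/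
private theorem iota_C_mul (c : ℤ_[p]) (x : IwasawaAlgebra p) :
    iwasawaToPowerSeries p (PowerSeries.C c * x) =
      PowerSeries.C (c : ℚ_[p]) * iwasawaToPowerSeries p x := by
  rw [map_mul, PowerSeries.map_C]; rfl

/-- `ι(C p ^ m · x) = C (p ^ m) · ι x`. [folklore] -/
private theorem iota_Cp_pow_mul (m : ℕ) (x : IwasawaAlgebra p) :
    iwasawaToPowerSeries p (PowerSeries.C (p : ℤ_[p]) ^ m * x) =
      PowerSeries.C ((p : ℚ_[p]) ^ m) * iwasawaToPowerSeries p x := by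
  rw [← map_pow, iota_C_mul, PadicInt.coe_pow, PadicInt.coe_natCast]

/-- `ι(C c) = C c`. [folklore] -/
private theorem iota_C (c : ℤ_[p]) :
    iwasawaToPowerSeries p (PowerSeries.C c) = PowerSeries.C (c : ℚ_[p]) := by
  rw [← mul_one (PowerSeries.C c : IwasawaAlgebra p), iota_C_mul, map_one, mul_one]

/-- A non-zero integer is a unit times a power of `p` in `ℤ_p`. [folklore] -/
private theorem exists_unit_mul_pow_eq_intCast {n : ℤ} (hn : n ≠ 0) :
    ∃ (u : ℤ_[p]ˣ) (b : ℕ), (n : ℤ_[p]) = (u : ℤ_[p]) * (p : ℤ_[p]) ^ b := by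
  have hn' : (n : ℤ_[p]) ≠ 0 := Int.cast_ne_zero.mpr hn
  exact ⟨PadicInt.unitCoeff hn', (n : ℤ_[p]).valuation, PadicInt.unitCoeff_spec hn'⟩

omit [W.IsElliptic] in
/-- A generator of the characteristic ideal of a dual datum is non-zero (`char ≠ ⊥` over the domain `Λ`). [folklore] -/
theorem ne_zero_of_charIdeal_eq_span (D : SignedSelmerDualData W κ γ ε) {g : IwasawaAlgebra p}
    (hg : D.charIdeal = Ideal.span {g}) : g ≠ 0 := by
  rintro rfl
  apply Module.charIdeal_ne_bot (IwasawaAlgebra p) D.X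
  have h : charIdeal (IwasawaAlgebra p) D.X = Ideal.span {(0 : IwasawaAlgebra p)} := hg
  rw [h, Ideal.span_singleton_eq_bot]

/-- **`char X^ε = (g)` pins the local lengths of a torsion dual datum: `ℓ_𝔭(X^ε) = ℓ_𝔭(Λ/(g))` at every height-one `𝔭`**
(`char(Λ/(g)) = (g)` and Skinner–Urban §3.1.6 in both directions). [cite: Washington1997, §13.2] -/
theorem lengthAt_eq_lengthAt_quotient_of_charIdeal_eq (hγ : κ.IsTopGenerator γ)
    (D : SignedSelmerDualData W κ γ ε) (hX : Module.IsTorsion (IwasawaAlgebra p) D.X) {g : IwasawaAlgebra p}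
    (hg : D.charIdeal = Ideal.span {g}) (𝔭 : PrimeSpectrum (IwasawaAlgebra p)) (h𝔭 : 𝔭.asIdeal.height = 1) :
    lengthAt (IwasawaAlgebra p) D.X 𝔭 = lengthAt (IwasawaAlgebra p) (IwasawaAlgebra p ⧸ Ideal.span {g}) 𝔭 := by
  haveI : Module.Finite (IwasawaAlgebra p) D.X := D.moduleFinite hγ
  have hg0 : g ≠ 0 := ne_zero_of_charIdeal_eq_span D hg
  have hQ := isTorsion_quotient_span_singleton (p := p) hg0
  have hcharQ : charIdeal (IwasawaAlgebra p) (IwasawaAlgebra p ⧸ Ideal.span {g}) = Ideal.span {g} :=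
    charIdeal_eq_span_of_lengthAt_eq_quotient hg0 fun _ _ ↦ rfl
  have h1 : charIdeal (IwasawaAlgebra p) D.X = charIdeal (IwasawaAlgebra p) (IwasawaAlgebra p ⧸ Ideal.span {g}) := by
    rw [hcharQ]; exact hg
  exact le_antisymm (SkinnerUrban2014.lengthAt_le_of_charIdeal_le hQ hX h1.symm.le 𝔭 h𝔭)
    (SkinnerUrban2014.lengthAt_le_of_charIdeal_le hX hQ h1.le 𝔭 h𝔭)

/-- **LOWER shape ⟸ lengths (the Eisenstein half, modulo powers of `p`).** If `X^ε` is torsion and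
`ℓ_𝔭(Λ/(L)) ≤ ℓ_𝔭(X^ε)` at every height-one `𝔭 ∌ p`, then `∃ g h m m', char X^ε = (g)` and
`C(p^{m'})·ι g = C(p^m·ϖ)·ι(L·h)` — i.e. `L` divides a generator of `char X^ε` in `Λ ⊗ ℚ_p`. Proof: `char X^ε = (g)`
(principal), `ℓ_𝔭(Λ/(L)) ≤ ℓ_𝔭(Λ/(g))` off `p`, so `p^{m'}·g ∈ char(Λ/(L)) = (L)` (tree:
`Module.exists_pow_mul_mem_charIdeal_of_lengthAt_le`, Washington §13.2), and the period ratio `ϖ = n/d`, `n = u·p^b`, is absorbed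
into `h` and the exponents. [cite: Washington1997, §13.2] [cite: Kobayashi2003, Thm. 1.3 (i) (p. 2)] -/
theorem exists_lowerUpTo_of_lengthAt_le (hγ : κ.IsTopGenerator γ) (D : SignedSelmerDualData W κ γ ε)
    {L : IwasawaAlgebra p} (hL : L ≠ 0) {ϖ : ℚ} (hϖ : ϖ ≠ 0) (hX : Module.IsTorsion (IwasawaAlgebra p) D.X)
    (h : ∀ 𝔭 : PrimeSpectrum (IwasawaAlgebra p), 𝔭.asIdeal.height = 1 →
      PowerSeries.C (p : ℤ_[p]) ∉ 𝔭.asIdeal →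
        lengthAt (IwasawaAlgebra p) (IwasawaAlgebra p ⧸ Ideal.span {L}) 𝔭 ≤ lengthAt (IwasawaAlgebra p) D.X 𝔭) :
    ∃ (g h : IwasawaAlgebra p) (m m' : ℕ), D.charIdeal = Ideal.span {g} ∧
      PowerSeries.C ((p : ℚ_[p]) ^ m') * iwasawaToPowerSeries p g =
        PowerSeries.C ((p : ℚ_[p]) ^ m * (ϖ : ℚ_[p])) * iwasawaToPowerSeries p (L * h) := by
  haveI : Module.Finite (IwasawaAlgebra p) D.X := D.moduleFinite hγ
  have hpP : Prime (PowerSeries.C (p : ℤ_[p]) : IwasawaAlgebra p) := IwasawaAlgebra.prime_C p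
  obtain ⟨g, hg⟩ := (charIdeal_isPrincipal_holds p D.X).principal
  have hg' : D.charIdeal = Ideal.span {g} := hg
  have hg0 : g ≠ 0 := ne_zero_of_charIdeal_eq_span D hg'
  have hlen := lengthAt_eq_lengthAt_quotient_of_charIdeal_eq hγ D hX hg'
  -- `p^{m'} · g ∈ char(Λ/(L)) = (L)`
  have hQL := isTorsion_quotient_span_singleton (p := p) hL
  obtain ⟨m', hm'⟩ := exists_pow_mul_mem_charIdeal_of_lengthAt_le hQL hpP hg0
    fun 𝔭 h𝔭 hp𝔭 ↦ (h 𝔭 h𝔭 hp𝔭).trans (hlen 𝔭 h𝔭).le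
  have hcharL : charIdeal (IwasawaAlgebra p) (IwasawaAlgebra p ⧸ Ideal.span {L}) = Ideal.span {L} :=
    charIdeal_eq_span_of_lengthAt_eq_quotient hL fun _ _ ↦ rfl
  rw [hcharL] at hm'
  obtain ⟨h₀, hh₀⟩ := Ideal.mem_span_singleton'.mp hm'
  -- `ϖ = n / d`, `n = u · p^b` in `ℤ_p`
  set n : ℤ := ϖ.num with hndef
  set d : ℤ := (ϖ.den : ℤ) with hddef
  have hn : n ≠ 0 := Rat.num_ne_zero.mpr hϖ
  obtain ⟨u, b, hu⟩ := exists_unit_mul_pow_eq_intCast (p := p) hn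
  have hϖnd : (ϖ : ℚ_[p]) * ((d : ℤ_[p]) : ℚ_[p]) = ((n : ℤ_[p]) : ℚ_[p]) := by
    rw [PadicInt.coe_intCast, PadicInt.coe_intCast, hndef, hddef]
    have h := Rat.mul_den_eq_num ϖ
    exact_mod_cast congrArg (fun q : ℚ ↦ (q : ℚ_[p])) h
  have huu : ((u : ℤ_[p]) : ℚ_[p]) * (((u⁻¹ : ℤ_[p]ˣ) : ℤ_[p]) : ℚ_[p]) = 1 := by
    rw [← PadicInt.coe_mul, Units.mul_inv, PadicInt.coe_one]
  have hnq : ((n : ℤ_[p]) : ℚ_[p]) = ((u : ℤ_[p]) : ℚ_[p]) * (p : ℚ_[p]) ^ b := by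
    rw [hu, PadicInt.coe_mul, PadicInt.coe_pow, PadicInt.coe_natCast]
  -- the scalar identity `p^b = ϖ · d · u⁻¹`
  have hscal : ((p : ℚ_[p]) ^ b) =
      (ϖ : ℚ_[p]) * ((d : ℤ_[p]) : ℚ_[p]) * (((u⁻¹ : ℤ_[p]ˣ) : ℤ_[p]) : ℚ_[p]) := by
    rw [hϖnd, hnq]
    linear_combination ((p : ℚ_[p]) ^ b) * huu.symm
  refine ⟨g, h₀ * PowerSeries.C (d : ℤ_[p]) * PowerSeries.C ((u⁻¹ : ℤ_[p]ˣ) : ℤ_[p]), 0, m' + b, hg', ?_⟩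
  -- `C(p^{m'+b})·ι g = C(p^b)·ι(p^{m'} g) = C(p^b)·ι(L h₀) = C(ϖ)·ι(L·h₀·C d·C u⁻¹)`
  have e1 : iwasawaToPowerSeries p (PowerSeries.C (p : ℤ_[p]) ^ m' * g) = iwasawaToPowerSeries p (L * h₀) := by
    rw [← hh₀, mul_comm h₀ L]
  rw [iota_Cp_pow_mul] at e1
  calc PowerSeries.C ((p : ℚ_[p]) ^ (m' + b)) * iwasawaToPowerSeries p g
      = PowerSeries.C ((p : ℚ_[p]) ^ b) * (PowerSeries.C ((p : ℚ_[p]) ^ m') * iwasawaToPowerSeries p g) := by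
        rw [pow_add, map_mul]; ring
    _ = PowerSeries.C ((p : ℚ_[p]) ^ b) * iwasawaToPowerSeries p (L * h₀) := by rw [e1]
    _ = PowerSeries.C ((ϖ : ℚ_[p]) * ((d : ℤ_[p]) : ℚ_[p]) * (((u⁻¹ : ℤ_[p]ˣ) : ℤ_[p]) : ℚ_[p])) *
          iwasawaToPowerSeries p (L * h₀) := by rw [← hscal]
    _ = PowerSeries.C ((p : ℚ_[p]) ^ 0 * (ϖ : ℚ_[p])) *
          iwasawaToPowerSeries p (L * (h₀ * PowerSeries.C (d : ℤ_[p]) * PowerSeries.C ((u⁻¹ : ℤ_[p]ˣ) : ℤ_[p]))) := by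
        rw [pow_zero, one_mul]
        simp only [map_mul, iota_C]
        ring

/-- **LOWER shape ⟹ lengths.** Conversely, `char X^ε = (g)` with `C(p^{m'})·ι g = C(p^m·ϖ)·ι(L·h)` forces
`ℓ_𝔭(Λ/(L)) ≤ ℓ_𝔭(X^ε)` at every height-one `𝔭 ∌ p` (clear the denominator of `ϖ`: `L ∣ p^{m'+c}·u'·g` in `Λ`, then lengths are
additive on cyclic modules and blind to `p`-powers and units off `p`). [cite: Washington1997, §13.2] -/
theorem lengthAt_le_of_lowerUpTo (hγ : κ.IsTopGenerator γ) (D : SignedSelmerDualData W κ γ ε)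
    {L : IwasawaAlgebra p} (hL : L ≠ 0) {ϖ : ℚ} (hX : Module.IsTorsion (IwasawaAlgebra p) D.X)
    {g h : IwasawaAlgebra p} {m m' : ℕ} (hg : D.charIdeal = Ideal.span {g})
    (he : PowerSeries.C ((p : ℚ_[p]) ^ m') * iwasawaToPowerSeries p g =
      PowerSeries.C ((p : ℚ_[p]) ^ m * (ϖ : ℚ_[p])) * iwasawaToPowerSeries p (L * h))
    (𝔭 : PrimeSpectrum (IwasawaAlgebra p)) (h𝔭 : 𝔭.asIdeal.height = 1)
    (hp𝔭 : PowerSeries.C (p : ℤ_[p]) ∉ 𝔭.asIdeal) :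
    lengthAt (IwasawaAlgebra p) (IwasawaAlgebra p ⧸ Ideal.span {L}) 𝔭 ≤ lengthAt (IwasawaAlgebra p) D.X 𝔭 := by
  haveI : Module.Finite (IwasawaAlgebra p) D.X := D.moduleFinite hγ
  have hpP : Prime (PowerSeries.C (p : ℤ_[p]) : IwasawaAlgebra p) := IwasawaAlgebra.prime_C p
  -- `ϖ = n / d`, `d = u' · p^c` in `ℤ_p`
  set n : ℤ := ϖ.num with hndef
  set d : ℤ := (ϖ.den : ℤ) with hddef
  have hd : d ≠ 0 := Int.natCast_ne_zero.mpr ϖ.den_nz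
  obtain ⟨u', c, hu'⟩ := exists_unit_mul_pow_eq_intCast (p := p) hd
  have hϖnd : (ϖ : ℚ_[p]) * ((d : ℤ_[p]) : ℚ_[p]) = ((n : ℤ_[p]) : ℚ_[p]) := by
    rw [PadicInt.coe_intCast, PadicInt.coe_intCast, hndef, hddef]
    have h := Rat.mul_den_eq_num ϖ
    exact_mod_cast congrArg (fun q : ℚ ↦ (q : ℚ_[p])) h
  -- clear denominators: `ι(C(p)^{m'} · C d · g) = ι(C(p)^m · C n · L · h)`
  have hCn : PowerSeries.C (((n : ℤ_[p]) : ℚ_[p])) =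
      PowerSeries.C (ϖ : ℚ_[p]) * PowerSeries.C (((d : ℤ_[p]) : ℚ_[p])) := by
    rw [← map_mul, hϖnd]
  have key : iwasawaToPowerSeries p (PowerSeries.C (p : ℤ_[p]) ^ m' * (PowerSeries.C (d : ℤ_[p]) * g)) =
      iwasawaToPowerSeries p (PowerSeries.C (p : ℤ_[p]) ^ m * (PowerSeries.C (n : ℤ_[p]) * (L * h))) := by
    have he' := he
    simp only [map_mul, map_pow] at he'
    simp only [map_mul, map_pow, iota_C, hCn, PadicInt.coe_natCast]
    linear_combination (PowerSeries.C (((d : ℤ_[p]) : ℚ_[p]))) * he'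
  have keyΛ : PowerSeries.C (p : ℤ_[p]) ^ m' * (PowerSeries.C (d : ℤ_[p]) * g) =
      PowerSeries.C (p : ℤ_[p]) ^ m * (PowerSeries.C (n : ℤ_[p]) * (L * h)) :=
    iwasawaToPowerSeries_injective p key
  -- hence `L ∣ C(p)^{m'+c} · (C u' · g)`
  have hdvd : PowerSeries.C (p : ℤ_[p]) ^ (m' + c) * (PowerSeries.C ((u' : ℤ_[p])) * g) =
      L * (PowerSeries.C (p : ℤ_[p]) ^ m * PowerSeries.C (n : ℤ_[p]) * h) := by
    have : (PowerSeries.C (d : ℤ_[p]) : IwasawaAlgebra p) =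
        PowerSeries.C ((u' : ℤ_[p])) * PowerSeries.C (p : ℤ_[p]) ^ c := by
      rw [hu', map_mul, map_pow, map_natCast]
    calc PowerSeries.C (p : ℤ_[p]) ^ (m' + c) * (PowerSeries.C ((u' : ℤ_[p])) * g)
        = PowerSeries.C (p : ℤ_[p]) ^ m' * (PowerSeries.C (d : ℤ_[p]) * g) := by rw [this]; ring
      _ = L * (PowerSeries.C (p : ℤ_[p]) ^ m * PowerSeries.C (n : ℤ_[p]) * h) := by rw [keyΛ]; ring
  -- lengths: `ℓ(Λ/(L)) ≤ ℓ(Λ/(L·k)) = ℓ(Λ/(p^{m'+c}·(u' g))) = ℓ(Λ/(u' g)) = ℓ(Λ/(g)) = ℓ(X^ε)`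
  have hunit : IsUnit (PowerSeries.C ((u' : ℤ_[p])) : IwasawaAlgebra p) := (Units.isUnit u').map PowerSeries.C
  calc lengthAt (IwasawaAlgebra p) (IwasawaAlgebra p ⧸ Ideal.span {L}) 𝔭
      ≤ lengthAt (IwasawaAlgebra p) (IwasawaAlgebra p ⧸ Ideal.span {L}) 𝔭 +
          lengthAt (IwasawaAlgebra p)
            (IwasawaAlgebra p ⧸ Ideal.span {PowerSeries.C (p : ℤ_[p]) ^ m * PowerSeries.C (n : ℤ_[p]) * h}) 𝔭 :=
        le_self_add
    _ = lengthAt (IwasawaAlgebra p)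
          (IwasawaAlgebra p ⧸ Ideal.span {PowerSeries.C (p : ℤ_[p]) ^ (m' + c) * (PowerSeries.C ((u' : ℤ_[p])) * g)}) 𝔭 := by
        rw [hdvd, lengthAt_quotient_span_singleton_mul _ hL]
    _ = lengthAt (IwasawaAlgebra p) (IwasawaAlgebra p ⧸ Ideal.span {g}) 𝔭 := by
        rw [SignedKatoOffTwo.lengthAt_quotient_span_pow_mul_eq_of_not_mem hpP (m' + c) _ 𝔭 hp𝔭,
          Ideal.span_singleton_mul_left_unit hunit]
    _ = lengthAt (IwasawaAlgebra p) D.X 𝔭 := (lengthAt_eq_lengthAt_quotient_of_charIdeal_eq hγ D hX hg 𝔭 h𝔭).symm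

/-- **(LD±p^k) in lengths.** For a torsion dual datum, `L ≠ 0`, `ϖ ≠ 0`: the LOWER shape
`∃ g h m m', char X^ε = (g) ∧ C(p^{m'})·ι g = C(p^m·ϖ)·ι(L·h)` holds iff `ℓ_𝔭(Λ/(L)) ≤ ℓ_𝔭(X^ε)` at every height-one
`𝔭 ∌ p`. [cite: Kobayashi2003, Thm. 1.3 (i) (p. 2)] [cite: Washington1997, §13.2] -/
theorem lowerUpTo_iff_lengthAt_le_off_p (hγ : κ.IsTopGenerator γ) (D : SignedSelmerDualData W κ γ ε)
    {L : IwasawaAlgebra p} (hL : L ≠ 0) {ϖ : ℚ} (hϖ : ϖ ≠ 0) (hX : Module.IsTorsion (IwasawaAlgebra p) D.X) :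
    (∃ (g h : IwasawaAlgebra p) (m m' : ℕ), D.charIdeal = Ideal.span {g} ∧
      PowerSeries.C ((p : ℚ_[p]) ^ m') * iwasawaToPowerSeries p g =
        PowerSeries.C ((p : ℚ_[p]) ^ m * (ϖ : ℚ_[p])) * iwasawaToPowerSeries p (L * h)) ↔
    ∀ 𝔭 : PrimeSpectrum (IwasawaAlgebra p), 𝔭.asIdeal.height = 1 →
      PowerSeries.C (p : ℤ_[p]) ∉ 𝔭.asIdeal →
        lengthAt (IwasawaAlgebra p) (IwasawaAlgebra p ⧸ Ideal.span {L}) 𝔭 ≤ lengthAt (IwasawaAlgebra p) D.X 𝔭 :=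
  ⟨fun ⟨_, _, _, _, hg, he⟩ 𝔭 h𝔭 hp𝔭 ↦ lengthAt_le_of_lowerUpTo hγ D hL hX hg he 𝔭 h𝔭 hp𝔭,
    exists_lowerUpTo_of_lengthAt_le hγ D hL hϖ hX⟩

/-- **TWO-SIDED shape ⟸ equal lengths.** If `X^ε` is torsion and `ℓ_𝔭(X^ε) = ℓ_𝔭(Λ/(L))` at every height-one `𝔭 ∌ p`, then
`∃ g m m', char X^ε = (g) ∧ C(p^{m'})·ι g = C(p^m·ϖ)·ι L`. Proof: the upper shape `ι(g₁·h₁) = C(p^{m₁}ϖ)·ι L`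
(`SignedKatoOffTwo.katoUpTo_iff_lengthAt_le_off_p`) and the lower shape for the SAME principal ideal give
`p^{a}·v = p^{m₂}·h₁·h₂` (`v` a unit), so `h₁ ∣ p^{a}` and `h₁ = w·p^i` (`Λ` a UFD, `p` prime: `dvd_prime_pow`); move `w` into
the generator. [cite: Washington1997, §13.2] [cite: PollackRubin2004, Thm. 7.3 (the shape; p > 2)] -/
theorem exists_upTo_of_lengthAt_eq (hγ : κ.IsTopGenerator γ) (D : SignedSelmerDualData W κ γ ε)
    {L : IwasawaAlgebra p} (hL : L ≠ 0) {ϖ : ℚ} (hϖ : ϖ ≠ 0) (hX : Module.IsTorsion (IwasawaAlgebra p) D.X)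
    (h : ∀ 𝔭 : PrimeSpectrum (IwasawaAlgebra p), 𝔭.asIdeal.height = 1 →
      PowerSeries.C (p : ℤ_[p]) ∉ 𝔭.asIdeal →
        lengthAt (IwasawaAlgebra p) D.X 𝔭 = lengthAt (IwasawaAlgebra p) (IwasawaAlgebra p ⧸ Ideal.span {L}) 𝔭) :
    ∃ (g : IwasawaAlgebra p) (m m' : ℕ), D.charIdeal = Ideal.span {g} ∧
      PowerSeries.C ((p : ℚ_[p]) ^ m') * iwasawaToPowerSeries p g =
        PowerSeries.C ((p : ℚ_[p]) ^ m * (ϖ : ℚ_[p])) * iwasawaToPowerSeries p L := by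
  have hpP : Prime (PowerSeries.C (p : ℤ_[p]) : IwasawaAlgebra p) := IwasawaAlgebra.prime_C p
  -- (a) the upper (Kato) shape
  obtain ⟨g₁, h₁, m₁, hg₁, he₁⟩ := (SignedKatoOffTwo.katoUpTo_iff_lengthAt_le_off_p hγ D hL hϖ).mpr
    fun _ 𝔭 h𝔭 hp𝔭 ↦ (h 𝔭 h𝔭 hp𝔭).le
  -- (b) the lower (Eisenstein) shape
  obtain ⟨g₂, h₂, m₂, m₂', hg₂, he₂⟩ := exists_lowerUpTo_of_lengthAt_le hγ D hL hϖ hX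
    fun 𝔭 h𝔭 hp𝔭 ↦ (h 𝔭 h𝔭 hp𝔭).ge
  have hg₁0 : g₁ ≠ 0 := ne_zero_of_charIdeal_eq_span D hg₁
  -- the two generators are associated: `g₁ · v = g₂`
  have hassoc : Associated g₁ g₂ := Ideal.span_singleton_eq_span_singleton.mp (hg₁.symm.trans hg₂)
  obtain ⟨v, hv⟩ := hassoc
  -- `ι(C(p)^{m₂'+m₁} · v · g₁) = ι(C(p)^{m₂} · h₁ · h₂ · g₁)`
  have key : iwasawaToPowerSeries p (PowerSeries.C (p : ℤ_[p]) ^ (m₂' + m₁) * ((v : IwasawaAlgebra p) * g₁)) =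
      iwasawaToPowerSeries p (PowerSeries.C (p : ℤ_[p]) ^ m₂ * (h₁ * h₂ * g₁)) := by
    have he₁' := he₁
    have he₂' := he₂
    rw [← hv] at he₂'
    simp only [map_mul, map_pow] at he₁' he₂'
    simp only [map_mul, map_pow, iota_C, PadicInt.coe_natCast]
    linear_combination (PowerSeries.C (p : ℚ_[p])) ^ m₁ * he₂' -
      (PowerSeries.C (p : ℚ_[p])) ^ m₂ * iwasawaToPowerSeries p h₂ * he₁'
  have keyΛ : PowerSeries.C (p : ℤ_[p]) ^ (m₂' + m₁) * ((v : IwasawaAlgebra p) * g₁) =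
      PowerSeries.C (p : ℤ_[p]) ^ m₂ * (h₁ * h₂ * g₁) := iwasawaToPowerSeries_injective p key
  have keyΛ' : PowerSeries.C (p : ℤ_[p]) ^ (m₂' + m₁) * (v : IwasawaAlgebra p) =
      h₁ * (PowerSeries.C (p : ℤ_[p]) ^ m₂ * h₂) := by
    apply mul_right_cancel₀ hg₁0
    calc PowerSeries.C (p : ℤ_[p]) ^ (m₂' + m₁) * (v : IwasawaAlgebra p) * g₁
        = PowerSeries.C (p : ℤ_[p]) ^ (m₂' + m₁) * ((v : IwasawaAlgebra p) * g₁) := by ring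
      _ = PowerSeries.C (p : ℤ_[p]) ^ m₂ * (h₁ * h₂ * g₁) := keyΛ
      _ = h₁ * (PowerSeries.C (p : ℤ_[p]) ^ m₂ * h₂) * g₁ := by ring
  -- `h₁ ∣ C(p)^{m₂'+m₁}`, hence `h₁ = w · C(p)^i`
  have hdvd : h₁ ∣ PowerSeries.C (p : ℤ_[p]) ^ (m₂' + m₁) := by
    have : h₁ ∣ PowerSeries.C (p : ℤ_[p]) ^ (m₂' + m₁) * (v : IwasawaAlgebra p) := ⟨_, keyΛ'⟩
    exact (Units.dvd_mul_right).mp this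
  obtain ⟨i, -, hi⟩ := (dvd_prime_pow hpP _).mp hdvd
  obtain ⟨w, hw⟩ := hi
  -- `h₁ · w = C(p)^i`; conclude with the generator `g₁ · w⁻¹`
  refine ⟨g₁ * ((w⁻¹ : (IwasawaAlgebra p)ˣ) : IwasawaAlgebra p), m₁, i, ?_, ?_⟩
  · rw [hg₁, Ideal.span_singleton_mul_right_unit (Units.isUnit w⁻¹)]
  · have hh₁ : h₁ = PowerSeries.C (p : ℤ_[p]) ^ i * ((w⁻¹ : (IwasawaAlgebra p)ˣ) : IwasawaAlgebra p) := by
      rw [← hw, mul_assoc, Units.mul_inv, mul_one]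
    calc PowerSeries.C ((p : ℚ_[p]) ^ i) * iwasawaToPowerSeries p (g₁ * ((w⁻¹ : (IwasawaAlgebra p)ˣ) : IwasawaAlgebra p))
        = iwasawaToPowerSeries p (PowerSeries.C (p : ℤ_[p]) ^ i *
            (g₁ * ((w⁻¹ : (IwasawaAlgebra p)ˣ) : IwasawaAlgebra p))) := (iota_Cp_pow_mul i _).symm
      _ = iwasawaToPowerSeries p (g₁ * h₁) := by rw [hh₁]; congr 1; ring
      _ = PowerSeries.C ((p : ℚ_[p]) ^ m₁ * (ϖ : ℚ_[p])) * iwasawaToPowerSeries p L := he₁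

/-- **TWO-SIDED shape ⟹ equal lengths** (the converse: both halves of the dictionary). [cite: Washington1997, §13.2] -/
theorem lengthAt_eq_of_upTo (hγ : κ.IsTopGenerator γ) (D : SignedSelmerDualData W κ γ ε)
    {L : IwasawaAlgebra p} (hL : L ≠ 0) {ϖ : ℚ} (hϖ : ϖ ≠ 0) (hX : Module.IsTorsion (IwasawaAlgebra p) D.X)
    {g : IwasawaAlgebra p} {m m' : ℕ} (hg : D.charIdeal = Ideal.span {g})
    (he : PowerSeries.C ((p : ℚ_[p]) ^ m') * iwasawaToPowerSeries p g =
      PowerSeries.C ((p : ℚ_[p]) ^ m * (ϖ : ℚ_[p])) * iwasawaToPowerSeries p L)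
    (𝔭 : PrimeSpectrum (IwasawaAlgebra p)) (h𝔭 : 𝔭.asIdeal.height = 1)
    (hp𝔭 : PowerSeries.C (p : ℤ_[p]) ∉ 𝔭.asIdeal) :
    lengthAt (IwasawaAlgebra p) D.X 𝔭 = lengthAt (IwasawaAlgebra p) (IwasawaAlgebra p ⧸ Ideal.span {L}) 𝔭 := by
  refine le_antisymm ?_ ?_
  · refine (SignedKatoOffTwo.katoUpTo_iff_lengthAt_le_off_p hγ D hL hϖ).mp
      ⟨g, PowerSeries.C (p : ℤ_[p]) ^ m', m, hg, ?_⟩ hX 𝔭 h𝔭 hp𝔭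
    rw [mul_comm g, iota_Cp_pow_mul, he]
  · refine lengthAt_le_of_lowerUpTo hγ D hL (ϖ := ϖ) hX (h := 1) (m := m) (m' := m') hg ?_ 𝔭 h𝔭 hp𝔭
    rw [mul_one, he]

/-- **(MC±p^k) in lengths.** For a torsion dual datum, `L ≠ 0`, `ϖ ≠ 0`: the TWO-SIDED shape
`∃ g m m', char X^ε = (g) ∧ C(p^{m'})·ι g = C(p^m·ϖ)·ι L` holds iff `ℓ_𝔭(X^ε) = ℓ_𝔭(Λ/(L))` at every height-one `𝔭 ∌ p`
— the signed main conjecture «away from `(p)`», blind to the period ratio and to `μ`.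
[cite: Kobayashi2003, Thm. 1.3 (p. 2)] [cite: Kato2004Asterisque, Lemma 15.13 (p. 264)] [cite: Washington1997, §13.2] -/
theorem upTo_iff_lengthAt_eq_off_p (hγ : κ.IsTopGenerator γ) (D : SignedSelmerDualData W κ γ ε)
    {L : IwasawaAlgebra p} (hL : L ≠ 0) {ϖ : ℚ} (hϖ : ϖ ≠ 0) (hX : Module.IsTorsion (IwasawaAlgebra p) D.X) :
    (∃ (g : IwasawaAlgebra p) (m m' : ℕ), D.charIdeal = Ideal.span {g} ∧
      PowerSeries.C ((p : ℚ_[p]) ^ m') * iwasawaToPowerSeries p g =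
        PowerSeries.C ((p : ℚ_[p]) ^ m * (ϖ : ℚ_[p])) * iwasawaToPowerSeries p L) ↔
    ∀ 𝔭 : PrimeSpectrum (IwasawaAlgebra p), 𝔭.asIdeal.height = 1 →
      PowerSeries.C (p : ℤ_[p]) ∉ 𝔭.asIdeal →
        lengthAt (IwasawaAlgebra p) D.X 𝔭 = lengthAt (IwasawaAlgebra p) (IwasawaAlgebra p ⧸ Ideal.span {L}) 𝔭 :=
  ⟨fun ⟨_, _, _, hg, he⟩ 𝔭 h𝔭 hp𝔭 ↦ lengthAt_eq_of_upTo hγ D hL hϖ hX hg he 𝔭 h𝔭 hp𝔭,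
    exists_upTo_of_lengthAt_eq hγ D hL hϖ hX⟩

end AnyPrime

end SignedLengthDoors

end Summit.BirchSwinnertonDyer.BirchSwinnertonDyer.Theorems

end
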